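import Literature.NumberTheory.Automorphic.ArchParameterTwistNorm
import Literature.NumberTheory.Automorphic.AlgebraicityParityGL
import HarnessLib

/-!
# Buzzard–Gee's half-twist at the level of automorphic representations:
# `C`-algebraic ↔ `L`-algebraic after `⊗ |det|^{±(n-1)/2}`, regularity preserved

Topic `NumberTheory/Automorphic`; theorems only. Buzzard–Gee (*The conjectural connections
between automorphic representations and Galois representations*, 2014), §5.3 after Def. 5.3.3:
`π` is `C`-algebraic iff `π ⊗ |det|^{(n-1)/2}` is `L`-algebraic (and for `n` even the two
notions differ, e.g. `n` odd/even parity of `|det|^{1/2}`, op. cit. §3.1). The tree had this on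
**infinity types** (`InfinityType.isCAlgebraic_iff_isLAlgebraic_twist`, and the parity analysis
of `AlgebraicityParityGL`, whose docstring lists as "NOT here: the statement `π` C-algebraic ↔
`π ⊗ |det|^{1/2}` L-algebraic … at the level of `AutomorphicRepData` (it needs the infinity type
of a twist)"); with the archimedean parameter of the Borel–Jacquet twist `π ⊗ |det|_𝔸^s` now
computed (`ArchParameterTwistNorm`: `HasInfinityType T → HasInfinityType (T.twist s)` for the
twisted datum), it becomes a statement about automorphic representation data of `GL_n(𝔸_K)`:

* `InfinityType.map_a_twist`, `IsRegular.twist`, `isLAlgebraic_iff_isCAlgebraic_twist`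
  (bookkeeping on infinity types; `twist_zero` is `AlgebraicityParityGL`'s, and the iff
  `isRegular_twist_iff` is `Literature.Barriers.Langlands.isRegular_twist_iff` of
  `Barriers/Langlands/NonRegularWeightBarrier`, not imported here).
* `AutomorphicRepData.IsCAlgebraic.exists_twist_isLAlgebraic` — `π` `C`-algebraic ⇒ the twist
  `π ⊗ |det|_𝔸^{(n-1)/2}` (a datum `π'` with `π'.W = |det|^{(n-1)/2} · W`) is `L`-algebraic;
  `AutomorphicRepData.IsLAlgebraic.exists_twist_isCAlgebraic` — conversely with `-(n-1)/2`;
  `AutomorphicRepData.IsRegularAlgebraic.exists_twist_isRegular_isLAlgebraic` — a regular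
  algebraic (Clozel) `π` has an `L`-algebraic twist with a REGULAR `L`-algebraic infinity type
  (the normalisation under which Hodge–Tate weights are integers, Buzzard–Gee Conj. 3.2.2);
  and the cuspidal variants (`CuspidalAutomorphicRepData`, twists of cusp forms are cusp forms,
  `exists_cuspidalAutomorphicRepData_map_mulChar_detTwist`).

All for `n ≥ 1` (`NeZero n`, as in `AutomorphicTwistNorm`).

## References

* K. Buzzard, T. Gee, LMS Lecture Note Ser. 414 (2014), Def. 3.1.1, §3.1, Def. 5.3.3 and the
  discussion after it. [BuzzardGee2014]
* A. Borel, H. Jacquet, Corvallis 1979, 5.7 (the twist `π ⊗ |det|^s`). [BorelJacquet1979]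
* L. Clozel, *Motifs et formes automorphes* (1990), Déf. 1.8, 3.12. [Clozel1990]
-/

noncomputable section

open scoped Classical
open NumberField

namespace Literature.NumberTheory.Automorphic

open Literature.NumberTheory.GaloisRepresentations (HeckeCharacter ideleGroup)

/-! ### Bookkeeping on infinity types -/

namespace InfinityType

variable {K : Type*} [Field K] {n : ℕ}

/-- The `a`-exponents of a twist are the shifted `a`-exponents. [cite: BuzzardGee2014, §3.1] -/
theorem map_a_twist (T : InfinityType K n) (s : ℂ) (σ : K →+* ℂ) :
    (T.twist s σ).map ArchWeight.a = ((T σ).map ArchWeight.a).map (· + s) := by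
  rw [twist_apply, Multiset.map_map, Multiset.map_map]
  rfl

/-- Twisting preserves regularity. [cite: Clozel1990, Définition 3.12] -/
theorem IsRegular.twist {T : InfinityType K n} (h : T.IsRegular) (s : ℂ) : (T.twist s).IsRegular :=
  fun σ => by
    rw [map_a_twist]
    exact (h σ).map (add_left_injective s)

/-- Buzzard–Gee, the other way round: `T` is `L`-algebraic iff its twist by `|det|^{-(n-1)/2}` is
`C`-algebraic. [cite: BuzzardGee2014, §5.3] -/
theorem isLAlgebraic_iff_isCAlgebraic_twist (T : InfinityType K n) :
    T.IsLAlgebraic ↔ (T.twist (-(((n : ℂ) - 1) / 2))).IsCAlgebraic := by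
  rw [isCAlgebraic_iff_isLAlgebraic_twist, twist_twist, neg_add_cancel, twist_zero]

end InfinityType

/-! ### The half-twist on automorphic representation data -/

namespace AutomorphicRepData

variable {n : ℕ} {K : Type} [Field K] [NumberField K] {hcpt : isCompact_glFiniteIntegralLevel n K}

/-- The real number `(n-1)/2` cast to `ℂ`. [folklore] -/
private theorem cast_half (n : ℕ) : ((((n : ℝ) - 1) / 2 : ℝ) : ℂ) = ((n : ℂ) - 1) / 2 := by
  push_cast; ring

/-- **`C`-algebraic ⇒ `L`-algebraic after the half-twist** (Buzzard–Gee 2014, §5.3): if `π` is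
`C`-algebraic then its twist `π ⊗ |det|_𝔸^{(n-1)/2}` — a datum `π'` with
`π'.W = |det|^{(n-1)/2} · W`, `π'.W' = |det|^{(n-1)/2} · W'` for the Hecke character
`χ = ‖·‖^{(n-1)/2}` — is `L`-algebraic. [cite: BuzzardGee2014, §5.3] -/
theorem IsCAlgebraic.exists_twist_isLAlgebraic [NeZero n]
    {π : AutomorphicRepData (AutomorphyDatum.gl n K hcpt)} (h : π.IsCAlgebraic) :
    ∃ (χ : HeckeCharacter K) (π' : AutomorphicRepData (AutomorphyDatum.gl n K hcpt)),
      (∀ x : ideleGroup K, ((χ x : ℂˣ) : ℂ) =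
        (GaloisRepresentations.ideleNorm x : ℂ) ^ ((((n : ℝ) - 1) / 2 : ℝ) : ℂ)) ∧
      π'.W = π.W.map (mulChar (detTwist n χ)) ∧ π'.W' = π.W'.map (mulChar (detTwist n χ)) ∧
      π'.IsLAlgebraic := by
  obtain ⟨T, hT, hC⟩ := h
  obtain ⟨χ, π', hχ, hW, hW', hT'⟩ := π.exists_twist_hasInfinityType (((n : ℝ) - 1) / 2) hT
  refine ⟨χ, π', hχ, hW, hW', T.twist _, hT', ?_⟩
  rw [cast_half]
  exact (InfinityType.isCAlgebraic_iff_isLAlgebraic_twist T).mp hC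

/-- **`L`-algebraic ⇒ `C`-algebraic after the inverse half-twist**: if `π` is `L`-algebraic then
`π ⊗ |det|_𝔸^{-(n-1)/2}` is `C`-algebraic. [cite: BuzzardGee2014, §5.3] -/
theorem IsLAlgebraic.exists_twist_isCAlgebraic [NeZero n]
    {π : AutomorphicRepData (AutomorphyDatum.gl n K hcpt)} (h : π.IsLAlgebraic) :
    ∃ (χ : HeckeCharacter K) (π' : AutomorphicRepData (AutomorphyDatum.gl n K hcpt)),
      (∀ x : ideleGroup K, ((χ x : ℂˣ) : ℂ) =
        (GaloisRepresentations.ideleNorm x : ℂ) ^ ((-(((n : ℝ) - 1) / 2) : ℝ) : ℂ)) ∧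
      π'.W = π.W.map (mulChar (detTwist n χ)) ∧ π'.W' = π.W'.map (mulChar (detTwist n χ)) ∧
      π'.IsCAlgebraic := by
  obtain ⟨T, hT, hL⟩ := h
  obtain ⟨χ, π', hχ, hW, hW', hT'⟩ := π.exists_twist_hasInfinityType (-(((n : ℝ) - 1) / 2)) hT
  refine ⟨χ, π', hχ, hW, hW', T.twist _, hT', ?_⟩
  rw [Complex.ofReal_neg, cast_half]
  exact (InfinityType.isLAlgebraic_iff_isCAlgebraic_twist T).mp hL

/-- **A regular algebraic `π` (Clozel) has an `L`-algebraic twist with a regular `L`-algebraic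
infinity type**: `π ⊗ |det|_𝔸^{(n-1)/2}` (the normalisation with integral Hodge–Tate weights,
Buzzard–Gee Conj. 3.2.2; regularity is twist-invariant). [cite: BuzzardGee2014, §5.3]
[cite: Clozel1990, Définition 3.12] -/
theorem IsRegularAlgebraic.exists_twist_isRegular_isLAlgebraic [NeZero n]
    {π : AutomorphicRepData (AutomorphyDatum.gl n K hcpt)} (h : π.IsRegularAlgebraic) :
    ∃ (χ : HeckeCharacter K) (π' : AutomorphicRepData (AutomorphyDatum.gl n K hcpt))
      (T' : InfinityType K n),
      (∀ x : ideleGroup K, ((χ x : ℂˣ) : ℂ) =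
        (GaloisRepresentations.ideleNorm x : ℂ) ^ ((((n : ℝ) - 1) / 2 : ℝ) : ℂ)) ∧
      π'.W = π.W.map (mulChar (detTwist n χ)) ∧ π'.W' = π.W'.map (mulChar (detTwist n χ)) ∧
      π'.HasInfinityType T' ∧ T'.IsRegular ∧ T'.IsLAlgebraic := by
  obtain ⟨T, hT, hC, hreg⟩ := h
  obtain ⟨χ, π', hχ, hW, hW', hT'⟩ := π.exists_twist_hasInfinityType (((n : ℝ) - 1) / 2) hT
  refine ⟨χ, π', T.twist _, hχ, hW, hW', hT', hreg.twist _, ?_⟩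
  rw [cast_half]
  exact (InfinityType.isCAlgebraic_iff_isLAlgebraic_twist T).mp hC

end AutomorphicRepData

/-! ### Cuspidal variants (twists of cusp forms are cusp forms) -/

namespace CuspidalAutomorphicRepData

variable {n : ℕ} {K : Type} [Field K] [NumberField K] {hcpt : isCompact_glFiniteIntegralLevel n K}

/-- **Twisting a cuspidal representation, with its infinity type** (`n ≥ 1`): for real `s` there
is a cuspidal datum `π' = π ⊗ |det|_𝔸^s` (`π'.W = |det|^s · W`) with infinity type `T.twist s`.
Borel–Jacquet 1979, 4.4 and 5.7. [cite: BorelJacquet1979, 5.7] -/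
theorem exists_twist_hasInfinityType [NeZero n] (π : CuspidalAutomorphicRepData n K hcpt) (s : ℝ)
    {T : InfinityType K n} (hT : π.1.HasInfinityType T) :
    ∃ (χ : HeckeCharacter K) (π' : CuspidalAutomorphicRepData n K hcpt),
      (∀ x : ideleGroup K,
        ((χ x : ℂˣ) : ℂ) = (GaloisRepresentations.ideleNorm x : ℂ) ^ ((s : ℝ) : ℂ)) ∧
      π'.1.W = π.1.W.map (mulChar (detTwist n χ)) ∧ π'.1.W' = π.1.W'.map (mulChar (detTwist n χ)) ∧
      π'.1.HasInfinityType (T.twist s) := by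
  obtain ⟨χ, hχ⟩ := exists_heckeCharacter_ideleNorm_cpow (K := K) ((s : ℝ) : ℂ)
  obtain ⟨π', hW, hW'⟩ := exists_cuspidalAutomorphicRepData_map_mulChar_detTwist hχ π
  exact ⟨χ, π', hχ, hW, hW',
    AutomorphicRepData.HasInfinityType.of_map_mulChar_detTwist hχ hW hW' hT⟩

/-- **A regular algebraic cuspidal `π` has a cuspidal `L`-algebraic twist with a regular
`L`-algebraic infinity type** (`π ⊗ |det|^{(n-1)/2}`). [cite: BuzzardGee2014, §5.3]
[cite: Clozel1990, Définition 3.12] -/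
theorem exists_twist_isRegular_isLAlgebraic [NeZero n] (π : CuspidalAutomorphicRepData n K hcpt)
    (h : π.1.IsRegularAlgebraic) :
    ∃ (χ : HeckeCharacter K) (π' : CuspidalAutomorphicRepData n K hcpt) (T' : InfinityType K n),
      (∀ x : ideleGroup K, ((χ x : ℂˣ) : ℂ) =
        (GaloisRepresentations.ideleNorm x : ℂ) ^ ((((n : ℝ) - 1) / 2 : ℝ) : ℂ)) ∧
      π'.1.W = π.1.W.map (mulChar (detTwist n χ)) ∧ π'.1.W' = π.1.W'.map (mulChar (detTwist n χ)) ∧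
      π'.1.HasInfinityType T' ∧ T'.IsRegular ∧ T'.IsLAlgebraic := by
  obtain ⟨T, hT, hC, hreg⟩ := h
  obtain ⟨χ, π', hχ, hW, hW', hT'⟩ := π.exists_twist_hasInfinityType (((n : ℝ) - 1) / 2) hT
  refine ⟨χ, π', T.twist _, hχ, hW, hW', hT', hreg.twist _, ?_⟩
  have e : ((((n : ℝ) - 1) / 2 : ℝ) : ℂ) = ((n : ℂ) - 1) / 2 := by push_cast; ring
  rw [e]
  exact (InfinityType.isCAlgebraic_iff_isLAlgebraic_twist T).mp hC

end CuspidalAutomorphicRepData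

end Literature.NumberTheory.Automorphic
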